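import Literature.Topology.FourManifolds.PlanarLevelTwist
import Literature.Topology.FourManifolds.RegularSublevelGlue
import HarnessLib

/-!
# Dehn twists of the boundary surface of a thickened planar domain about level circles

Topic `Literature/Topology/FourManifolds`; geometric layer of the Dehn-twist package of the
Dehn–Nielsen–Baer seat (`DehnNielsenBaerSurface.lean`), sequel of `PlanarLevelTwist.lean`.  For the
thickened planar handlebody `V = {q(x, y) + z² ≤ c} ⊂ ℝ³` with boundary surface
`F = {q + z² = c}` (`ThickenedPlanarHandlebody.lean`), the level circle `{q = c - h²} × {h}` of the
upper sheet is a simple closed curve on `F`; this file constructs **the Dehn twist of `F` about it**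
as a diffeomorphism of the abstract boundary manifold `∂V` (`RegularSublevel`, `(𝓡∂ 3).boundary`).

Such a twist is *not* the restriction of a `q + z²`-preserving diffeomorphism of `ℝ³` (those preserve
`V` and its complement, and a Dehn twist about a curve bounding a disc on neither side extends over
neither); instead (`RegularSublevelGlue.lean`) it is glued from two ambient models agreeing along `F`:
the time-`λ(z)` map `Φ(x) = θ(λ(z), x)` of the flow `θ` of `PlanarLevelTwist.lean` (preserving
`H = (q ∘ π, z)`, rotating the level circles) over the open family `O` of circles through a transversal,
and the identity off a compact core `K ⊂ O`; here `λ = 0` below the twisting annulus and `λ =` the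
period above it, so that `Φ = id` on `F ∩ (O ∖ K)`, and across the annulus the rotation number
`λ / period` increases from `0` to `1` (Farb–Margalit's twist map, §3.1.1).

Main results (namespace `Literature.Topology.FourManifolds.PlanarLevelTwist`):

* `contDiff_mul_of_support_subset` — smoothness of a cut-off product (real variable);
* `exists_surfaceDehnTwist` — **the Dehn twist**: for a regular level `c` of `q + z²` and a height
  `h₀` with `c - h₀²` in the regular band: the cut-off `ψ` and the flow `θ` of
  `PlanarLevelTwist.exists_planarLevelPackage` (velocity `twistField bE3 bF2 (levelPair q) ψ`), one
  positive period of the selected circle, and for every positive period `T₀` and every `ε₀ > 0`: the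
  period function `P` on `S`, a width
  `0 < ε ≤ ε₀`, a smooth `λ : ℝ → ℝ` with `λ = 0` on `(-∞, h₀ - ε]` and `λ(h) = P(c - h², h)` on
  `[h₀, h₀ + 2ε]`, and a diffeomorphism `T` of `∂V` which is `x ↦ θ(λ(z), x)` on the circles of the
  family below height `h₀ + 2ε` and the identity at every point off the family or of height outside
  `[h₀ - ε, h₀]`.

Everything is proved; no new definitions (D-0026).

## References

* B. Farb, D. Margalit, *A primer on mapping class groups*, PMS 49 (2012), §3.1.1 (PDF p. 62: the
  twist map `T(θ, t) = (θ + 2πt, t)` on an annulus, extended by the identity). [FarbMargalit2012]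
* J. M. Lee, *Introduction to Smooth Manifolds* (2013), Cor. 5.30. [LeeSmoothManifolds2013]
-/

open scoped Manifold ContDiff Topology
open Set Function Filter Metric

noncomputable section

namespace Literature.Topology.FourManifolds

open PlanarThickening Literature.Geometry.Manifold

/-- Local notation: `𝔼 n` is the model Euclidean space `EuclideanSpace ℝ (Fin n)`. -/
local notation "𝔼 " n:arg => EuclideanSpace ℝ (Fin n)

namespace PlanarLevelTwist

variable {q : 𝔼 2 → ℝ}

/-! ### §1 A smooth cut-off product -/

/-- **Smoothness of a cut-off product** `μ · g`: `μ` smooth vanishing off a closed set `C`, `g`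
smooth on an open set `W ⊇ C`. [folklore] -/
theorem contDiff_mul_of_support_subset {μ g : ℝ → ℝ} (hμ : ContDiff ℝ ∞ μ) {W C : Set ℝ}
    (hW : IsOpen W) (hg : ContDiffOn ℝ ∞ g W) (hC : IsClosed C) (hCW : C ⊆ W)
    (hsupp : ∀ h, μ h ≠ 0 → h ∈ C) : ContDiff ℝ ∞ fun h => μ h * g h := by
  refine contDiff_iff_contDiffAt.2 fun h => ?_
  by_cases hh : h ∈ W
  · exact hμ.contDiffAt.mul (hg.contDiffAt (hW.mem_nhds hh))
  · have hC' : h ∉ C := fun h' => hh (hCW h')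
    refine (contDiffAt_const (c := (0 : ℝ))).congr_of_eventuallyEq ?_
    filter_upwards [hC.isOpen_compl.mem_nhds hC'] with h' hh'
    have : μ h' = 0 := by by_contra hne; exact hh' (hsupp _ hne)
    simp [this]

/-! ### §2 The Dehn twist of the boundary surface about an upper level circle -/

/-- **The Dehn twist of the boundary surface `F = {q + z² = c}` about the level circle
`{q = c - h₀²} × {h₀}` through the transversal** (Farb–Margalit's twist map realised on `F`).  Data
as in `exists_planarLevelPackage` with `s₀ = c - h₀²`, `c` a regular value of `q + z²`.  Conclusion:
the cut-off `ψ` and the flow `θ` of `exists_planarLevelPackage` (smooth, complete, velocity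
`twistField bE3 bF2 (levelPair q) ψ`, preserving `(q ∘ π, z)`, fixing `{ψ = 0}` hence every point
of level or height outside the bands), one positive period of the selected circle, and for every positive period `T₀`
and every `ε₀ > 0`: the period function `P` on `S` (`P(s₀, h₀) = T₀`), a width `0 < ε ≤ ε₀` with the
parabola `h ↦ (c - h², h)` inside `S` on `[h₀ - 3ε, h₀ + 3ε]`, a smooth `λ` with `λ = 0` on
`(-∞, h₀ - ε]` and `λ(h) = P(c - h², h)` on `[h₀, h₀ + 2ε]`, and a self-diffeomorphism `T` of the
boundary `∂V` of `V = {q + z² ≤ c}` which is `x ↦ θ(λ(z), x)` at the boundary points on the circles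
of the family below height `h₀ + 2ε`, and the identity at those off the family or of height outside
`[h₀ - ε, h₀]`. [cite: FarbMargalit2012, §3.1.1] [cite: LeeSmoothManifolds2013, Cor. 5.30] -/
theorem exists_surfaceDehnTwist (hq : ContDiff ℝ ∞ q) (hcoer : ∀ s, IsCompact (q ⁻¹' Iic s))
    {c : ℝ} (hlev : IsRegularLevel (𝓡 3) (thicken q) c)
    {s₁ s₂ h₁ h₂ δ : ℝ} (hδ : 0 < δ)
    (hreg : ∀ p, q p ∈ Ioo (s₁ - 2 * δ) (s₂ + 2 * δ) → fderiv ℝ q p ≠ 0)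
    {γ : ℝ → 𝔼 2} (hγ : ContDiff ℝ ∞ γ) (hqγ : ∀ s ∈ Ioo (s₁ - 2 * δ) (s₂ + 2 * δ), q (γ s) = s)
    {h₀ : ℝ} (hs₀ : c - h₀ ^ 2 ∈ Icc s₁ s₂) (hh₀ : h₀ ∈ Icc h₁ h₂) :
    ∃ (ψ : 𝔼 3 → ℝ) (θ : ℝ × 𝔼 3 → 𝔼 3), ContDiff ℝ ∞ ψ ∧
      (∀ x, levelPair q x ∈ Ioo (s₁ - δ) (s₂ + δ) ×ˢ Ioo (h₁ - δ) (h₂ + δ) → ψ x = 1) ∧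
      (∀ x, (q (proj x) ∉ Ioo (s₁ - 2 * δ) (s₂ + 2 * δ) ∨ x 2 ∉ Ioo (h₁ - 2 * δ) (h₂ + 2 * δ)) →
        ψ x = 0) ∧
      ContDiff ℝ ∞ θ ∧ (∀ x, θ (0, x) = x) ∧ (∀ t s x, θ (t, θ (s, x)) = θ (t + s, x)) ∧
      (∀ x t, HasDerivAt (fun t => θ (t, x)) (twistField bE3 bF2 (levelPair q) ψ (θ (t, x))) t) ∧
      (∀ t x, levelPair q (θ (t, x)) = levelPair q x) ∧
      (∀ x, ψ x = 0 → ∀ t, θ (t, x) = x) ∧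
      (∃ T₀ : ℝ, 0 < T₀ ∧
        θ (T₀, lift (γ (c - h₀ ^ 2)) + h₀ • ez) = lift (γ (c - h₀ ^ 2)) + h₀ • ez) ∧
      ∀ T₀ : ℝ, 0 < T₀ →
        θ (T₀, lift (γ (c - h₀ ^ 2)) + h₀ • ez) = lift (γ (c - h₀ ^ 2)) + h₀ • ez →
        ∀ ε₀ : ℝ, 0 < ε₀ →
        ∃ (P : ℝ × ℝ → ℝ) (S : Set (ℝ × ℝ)) (ε : ℝ) (lam : ℝ → ℝ)
          (T : (𝓡∂ 3).boundary (RegularSublevel hlev) ≃ₘ⟮𝓡 2, 𝓡 2⟯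
            (𝓡∂ 3).boundary (RegularSublevel hlev)),
          IsOpen S ∧ (c - h₀ ^ 2, h₀) ∈ S ∧ S ⊆ Ioo (s₁ - δ) (s₂ + δ) ×ˢ Ioo (h₁ - δ) (h₂ + δ) ∧
          ContDiffOn ℝ ∞ P S ∧ P (c - h₀ ^ 2, h₀) = T₀ ∧ (∀ s ∈ S, 0 < P s) ∧
          (∀ s ∈ S, θ (P s, lift (γ s.1) + s.2 • ez) = lift (γ s.1) + s.2 • ez) ∧
          IsOpen (flowSaturation θ (fun s : ℝ × ℝ => lift (γ s.1) + s.2 • ez) S) ∧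
          0 < ε ∧ ε ≤ ε₀ ∧ (∀ h ∈ Icc (h₀ - 3 * ε) (h₀ + 3 * ε), (c - h ^ 2, h) ∈ S) ∧
          ContDiff ℝ ∞ lam ∧ (∀ h, h ≤ h₀ - ε → lam h = 0) ∧
          (∀ h ∈ Icc h₀ (h₀ + 2 * ε), lam h = P (c - h ^ 2, h)) ∧
          (∀ z, RegularSublevel.incl hlev z.1 ∈
              flowSaturation θ (fun s : ℝ × ℝ => lift (γ s.1) + s.2 • ez) S →
            RegularSublevel.incl hlev z.1 2 < h₀ + 2 * ε →
            RegularSublevel.incl hlev (T z).1 =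
              θ (lam (RegularSublevel.incl hlev z.1 2), RegularSublevel.incl hlev z.1)) ∧
          ∀ z, (RegularSublevel.incl hlev z.1 ∉
              flowSaturation θ (fun s : ℝ × ℝ => lift (γ s.1) + s.2 • ez) S ∨
            RegularSublevel.incl hlev z.1 2 ∉ Icc (h₀ - ε) h₀) → T z = z := by
  obtain ⟨ψ, θ, hψs, hψ1, hψzero, hθ, h0, hadd, hint, hHinv, hψfix, hper, hpack⟩ :=
    exists_planarLevelPackage hq hcoer hδ hreg hγ hqγ hs₀ hh₀
  refine ⟨ψ, θ, hψs, hψ1, hψzero, hθ, h0, hadd, hint, hHinv, hψfix, hper,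
    fun T₀ hT₀ hT ε₀ hε₀ => ?_⟩
  obtain ⟨P, S, hSo, hs₀S, hSJ, hPs, hP0, hPpos, hPS, hopen⟩ := hpack T₀ hT₀ hT
  set σ : ℝ × ℝ → 𝔼 3 := fun s => lift (γ s.1) + s.2 • ez with hσdef
  have hσc : Continuous σ :=
    (lift.continuous.comp (hγ.continuous.comp continuous_fst)).add (continuous_snd.smul continuous_const)
  have hσ2 : ∀ s : ℝ × ℝ, σ s 2 = s.2 := fun s => by simp [hσdef]
  set par : ℝ → ℝ × ℝ := fun h => (c - h ^ 2, h) with hpardef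
  have hpars : ContDiff ℝ ∞ par := (contDiff_const.sub (contDiff_id.pow 2)).prodMk contDiff_id
  have hparc : Continuous par := hpars.continuous
  have hheight : ∀ t x, θ (t, x) 2 = x 2 := fun t x => by
    have := hHinv t x
    simp only [levelPair_apply, Prod.mk.injEq] at this
    exact this.2
  have hcz : Continuous fun x : 𝔼 3 => x 2 := zc.continuous
  -- the width `ε`
  have hWo : IsOpen (par ⁻¹' S) := hSo.preimage hparc
  obtain ⟨r, hr, hball⟩ := Metric.isOpen_iff.1 hWo h₀ hs₀S
  set ε : ℝ := min (r / 4) ε₀ with hεdef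
  have hε : 0 < ε := lt_min (by linarith) hε₀
  have hεε₀ : ε ≤ ε₀ := min_le_right _ _
  have hεr : 3 * ε < r := by have := min_le_left (r / 4) ε₀; linarith
  have hparS : ∀ h ∈ Icc (h₀ - 3 * ε) (h₀ + 3 * ε), par h ∈ S := fun h hh =>
    hball (by rw [mem_ball, Real.dist_eq, abs_lt]; constructor <;> linarith [hh.1, hh.2])
  -- the twist profile `λ`
  set μ₁ : ℝ → ℝ := fun h => Real.smoothTransition ((h - (h₀ - ε)) / ε) with hμ₁def
  have hμ₁s : ContDiff ℝ ∞ μ₁ :=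
    Real.smoothTransition.contDiff.comp ((contDiff_id.sub contDiff_const).div_const _)
  have hμ₁0 : ∀ h, h ≤ h₀ - ε → μ₁ h = 0 := fun h hh =>
    Real.smoothTransition.zero_of_nonpos (div_nonpos_of_nonpos_of_nonneg (by linarith) hε.le)
  have hμ₁1 : ∀ h, h₀ ≤ h → μ₁ h = 1 := fun h hh =>
    Real.smoothTransition.one_of_one_le ((one_le_div hε).2 (by linarith))
  obtain ⟨μ₂, hμ₂s, -, hμ₂1, hμ₂supp⟩ := exists_plateau (a := h₀ - ε) (b := h₀ + ε) hε
  set lam : ℝ → ℝ := fun h => μ₁ h * (μ₂ h * P (par h)) with hlamdef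
  have hlams : ContDiff ℝ ∞ lam := by
    refine hμ₁s.mul (contDiff_mul_of_support_subset hμ₂s hWo
      (hPs.comp hpars.contDiffOn fun h hh => hh) isClosed_Icc
      (fun h hh => hparS h hh) fun h hh => ?_)
    have := hμ₂supp h hh
    exact ⟨by linarith [this.1], by linarith [this.2]⟩
  have hlam0 : ∀ h, h ≤ h₀ - ε → lam h = 0 := fun h hh => by
    show μ₁ h * (μ₂ h * P (par h)) = 0
    rw [hμ₁0 h hh, zero_mul]
  have hlam1 : ∀ h ∈ Icc h₀ (h₀ + 2 * ε), lam h = P (par h) := fun h hh => by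
    show μ₁ h * (μ₂ h * P (par h)) = P (par h)
    rw [hμ₁1 h hh.1, hμ₂1 h ⟨by linarith [hh.1], by linarith [hh.2]⟩, one_mul, one_mul]
  -- the two ambient models
  set Φ : 𝔼 3 → 𝔼 3 := fun x => θ (lam (x 2), x) with hΦdef
  set Φ' : 𝔼 3 → 𝔼 3 := fun x => θ (-lam (x 2), x) with hΦ'def
  have hΦs : ContDiff ℝ ∞ Φ := hθ.comp ((hlams.comp zc.contDiff).prodMk contDiff_id)
  have hΦ's : ContDiff ℝ ∞ Φ' := hθ.comp ((hlams.comp zc.contDiff).neg.prodMk contDiff_id)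
  have hΦm : ContMDiff (𝓡 3) (𝓡 3) ∞ Φ := contMDiff_iff_contDiff.2 hΦs
  have hΦ'm : ContMDiff (𝓡 3) (𝓡 3) ∞ Φ' := contMDiff_iff_contDiff.2 hΦ's
  have hΦt : ∀ x, thicken q (Φ x) = thicken q x := fun x =>
    thicken_eq_of_levelPair_eq (hHinv _ _)
  have hΦ't : ∀ x, thicken q (Φ' x) = thicken q x := fun x =>
    thicken_eq_of_levelPair_eq (hHinv _ _)
  have hinvΦ : ∀ x, Φ' (Φ x) = x := fun x => by
    show θ (-lam (θ (lam (x 2), x) 2), θ (lam (x 2), x)) = x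
    rw [hheight, hadd, neg_add_cancel, h0]
  have hinvΦ' : ∀ x, Φ (Φ' x) = x := fun x => by
    show θ (lam (θ (-lam (x 2), x) 2), θ (-lam (x 2), x)) = x
    rw [hheight, hadd, add_neg_cancel, h0]
  -- the open family `O` and the compact core `K`
  set O : Set (𝔼 3) := flowSaturation θ σ S ∩ {x | x 2 < h₀ + 2 * ε} with hOdef
  have hOo : IsOpen O := hopen.inter (isOpen_lt hcz continuous_const)
  have hcontP : ContinuousOn (fun h => P (par h)) (Icc (h₀ - ε) h₀) :=
    hPs.continuousOn.comp hparc.continuousOn fun h hh =>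
      hparS h ⟨by linarith [hh.1], by linarith [hh.2]⟩
  obtain ⟨hM, hMmem, hMmax⟩ :=
    isCompact_Icc.exists_isMaxOn (nonempty_Icc.2 (by linarith)) hcontP
  set K : Set (𝔼 3) :=
    (fun p : ℝ × ℝ => θ (p.2, σ (par p.1))) '' (Icc (h₀ - ε) h₀ ×ˢ Icc 0 (P (par hM))) with hKdef
  have hKc : IsCompact K :=
    (isCompact_Icc.prod isCompact_Icc).image
      (hθ.continuous.comp (continuous_snd.prodMk (hσc.comp (hparc.comp continuous_fst))))
  -- boundary points on the family lie on circles of the parabola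
  have hSat : ∀ x ∈ flowSaturation θ σ S, thicken q x = c →
      ∃ (u h' : ℝ), par h' ∈ S ∧ θ (u, σ (par h')) = x ∧ x 2 = h' := by
    intro x hx hxc
    obtain ⟨u, s', hs', rfl⟩ := mem_flowSaturation_iff.1 hx
    have hband' : s'.1 ∈ Ioo (s₁ - 2 * δ) (s₂ + 2 * δ) := by
      have := (hSJ hs').1
      exact ⟨by linarith [this.1], by linarith [this.2]⟩
    have hth : thicken q (σ s') = s'.1 + s'.2 ^ 2 := by
      rw [thicken_apply, hσ2]
      simp only [hσdef, map_add, map_smul, proj_lift, proj_ez, smul_zero, add_zero]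
      rw [hqγ _ hband']
    have hc' : s'.1 + s'.2 ^ 2 = c := by
      rw [← hth, ← thicken_eq_of_levelPair_eq (hHinv u (σ s'))]; exact hxc
    have hpar : par s'.2 = s' := Prod.ext (by show c - s'.2 ^ 2 = s'.1; linarith) rfl
    exact ⟨u, s'.2, hpar ▸ hs', by rw [hpar], by rw [hheight, hσ2]⟩
  have hKO : K ⊆ O := by
    rintro _ ⟨⟨h, t⟩, ⟨hh, -⟩, rfl⟩
    refine ⟨mem_flowSaturation_iff.2
      ⟨t, par h, hparS h ⟨by linarith [hh.1], by linarith [hh.2]⟩, rfl⟩, ?_⟩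
    show θ (t, σ (par h)) 2 < h₀ + 2 * ε
    rw [hheight, hσ2]
    show h < h₀ + 2 * ε
    linarith [hh.2]
  have hmemK : ∀ (u h' : ℝ), h' ∈ Icc (h₀ - ε) h₀ → θ (u, σ (par h')) ∈ K := by
    intro u h' hh'
    have hSp : par h' ∈ S := hparS h' ⟨by linarith [hh'.1], by linarith [hh'.2]⟩
    obtain ⟨r', hr', hru⟩ := exists_mem_Ico_apply_eq h0 hadd (hPpos _ hSp) (hPS _ hSp) u
    exact ⟨(h', r'), ⟨hh', ⟨hr'.1, hr'.2.le.trans (hMmax hh')⟩⟩, hru.symm⟩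
  -- the gluing hypotheses along the boundary surface
  have hid : ∀ x, thicken q x = c → x ∈ O → x ∉ K → Φ x = x ∧ Φ' x = x := by
    intro x hxc hxO hxK
    obtain ⟨u, h', hSp, rfl, hx2⟩ := hSat x hxO.1 hxc
    rcases le_or_gt h' (h₀ - ε) with hlo | hhi
    · have hl : lam h' = 0 := hlam0 h' hlo
      constructor
      · show θ (lam (θ (u, σ (par h')) 2), θ (u, σ (par h'))) = _
        rw [hx2, hl, h0]
      · show θ (-lam (θ (u, σ (par h')) 2), θ (u, σ (par h'))) = _
        rw [hx2, hl, neg_zero, h0]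
    · rcases le_or_gt h' h₀ with hmid | htop
      · exact absurd (hmemK u h' ⟨hhi.le, hmid⟩) hxK
      · have hlt : h' < h₀ + 2 * ε := by
          have : θ (u, σ (par h')) 2 < h₀ + 2 * ε := hxO.2
          rwa [hx2] at this
        have hl : lam h' = P (par h') := hlam1 h' ⟨htop.le, hlt.le⟩
        have hperx : θ (P (par h'), θ (u, σ (par h'))) = θ (u, σ (par h')) := by
          rw [hadd, add_comm, ← hadd, hPS _ hSp]
        constructor
        · show θ (lam (θ (u, σ (par h')) 2), θ (u, σ (par h'))) = _
          rw [hx2, hl]; exact hperx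
        · show θ (-lam (θ (u, σ (par h')) 2), θ (u, σ (par h'))) = _
          rw [hx2, hl]
          conv_lhs => rw [← hperx]
          rw [hadd, neg_add_cancel, h0]
  have hmaps : ∀ x, thicken q x = c → x ∈ O → Φ x ∈ O ∧ Φ' x ∈ O := by
    intro x _ hxO
    refine ⟨⟨flowSaturation_invariant hadd σ S _ hxO.1, ?_⟩,
      ⟨flowSaturation_invariant hadd σ S _ hxO.1, ?_⟩⟩
    · show θ (lam (x 2), x) 2 < h₀ + 2 * ε
      rw [hheight]; exact hxO.2
    · show θ (-lam (x 2), x) 2 < h₀ + 2 * ε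
      rw [hheight]; exact hxO.2
  have hinv : ∀ x, thicken q x = c → x ∈ O → Φ' (Φ x) = x ∧ Φ (Φ' x) = x :=
    fun x _ _ => ⟨hinvΦ x, hinvΦ' x⟩
  -- the diffeomorphism
  refine ⟨P, S, ε, lam, RegularSublevel.boundaryGlueDiffeomorph hlev hΦm hΦ'm hΦt hΦ't hOo
      hKc.isClosed hKO hid hmaps hinv, hSo, hs₀S, hSJ, hPs, hP0, hPpos, hPS, hopen, hε, hεε₀,
    hparS, hlams, hlam0, hlam1, fun z hz hz2 => ?_, fun z hz => ?_⟩
  · exact RegularSublevel.incl_boundaryGlueDiffeomorph_of_mem hlev hΦm hΦ'm hΦt hΦ't hOo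
      hKc.isClosed hKO hid hmaps hinv ⟨hz, hz2⟩
  · refine RegularSublevel.boundaryGlueDiffeomorph_apply_of_not_mem hlev hΦm hΦ'm hΦt hΦ't hOo
      hKc.isClosed hKO hid hmaps hinv fun hK' => ?_
    obtain ⟨⟨h, t⟩, ⟨hh, -⟩, hx⟩ := hK'
    rcases hz with hz | hz
    · exact hz (hx ▸ mem_flowSaturation_iff.2
        ⟨t, par h, hparS h ⟨by linarith [hh.1], by linarith [hh.2]⟩, rfl⟩)
    · apply hz
      rw [← hx, hheight, hσ2]
      exact hh

end PlanarLevelTwist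

end Literature.Topology.FourManifolds

end
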